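import Summits.CriticalPhenomena.Ising3DConformalLimit.Theses.EnergyNotSigmaSquared
import Summits.CriticalPhenomena.Ising3DConformalLimit.Theorems.EnergyNotSigmaSquaredRungOneAdjacentMergingDefs
import Summits.CriticalPhenomena.Ising3DConformalLimit.Theorems.EnergyNotSigmaSquaredRungOneAdjacentMergingChebyshev
import Summits.CriticalPhenomena.Ising3DConformalLimit.Theorems.EnergyNotSigmaSquaredRungOneAdjacentMergingBoxPassage
import Summits.CriticalPhenomena.Ising3DConformalLimit.Theorems.EnergyNotSigmaSquaredRungOneAdjacentMergingCells
import Summits.CriticalPhenomena.Ising3DConformalLimit.Theorems.EnergyNotSigmaSquaredRungOneAdjacentMergingWindowRegular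
import Summits.CriticalPhenomena.Ising3DConformalLimit.Theorems.EnergyNotSigmaSquaredRungOneAdjacentMergingHarvestInputs
import Summits.CriticalPhenomena.Ising3DConformalLimit.Theorems.EnergyNotSigmaSquaredRungOneAdjacentMergingAbstractHarvest
import Summits.CriticalPhenomena.Ising3DConformalLimit.Theorems.EnergyNotSigmaSquaredRungOneAdjacentMergingAssembly
import HarnessLib

/-!
# `RungOneAdjacentMerging` (item stmt-CriticalPhenomena-11262, route `EnergyNotSigmaSquared`, rank 5) —
# proved along the line `dominant-shell-concentration`

THE CRUX.  In the free box `Λ_n ⊂ ℤ³` (nearest-neighbour graph of `ℤ³` induced on `box 3 n`) at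
`β_c(3)`, two independent sourced double currents `(n₁,n₃) ~ P^{{0}∆{x},∅}` and
`(n₂,n₄) ~ P^{{e₂}∆{x+e₂},∅}` (`e₂ = Pi.single 1 1`) have DISJOINT clusters
`C_{n₁+n₃}(0) ∩ C_{n₂+n₄}(e₂) = ∅` with probability `→ 0` as `‖x‖ → ∞` (`n → ∞` first): duplicated
critical strands tied at neighbouring nails always end up touching.  This is the `d = 3` mirror image of
Aizenman's `d > 4` avoidance lemma (Aizenman 1982) and of the `d = 4` logarithmic avoidance of
Aizenman–Duminil-Copin 2021; it was open.

THE PROOF (lead `prover-line-stmt-CriticalPhenomena-11262-0` with six stub workers; every piece is a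
theorem of the tree, imported above; vocabulary in `…RungOneAdjacentMergingDefs`).
LOG-SCALE CONCENTRATION OF A POINTWISE-NORMALISED COINCIDENCE COUNT.  With `G = ⟨σ₀σ_·⟩_{β_c}` on `ℤ³`,
`a(u) = G(u)G(x-u)/G(x)` and `a'(u) = a(u-e₂)` the EXACT one-point densities of the two systems, the
count `N = Σ_u c(u)𝟙[u ∈ C₁(0)]𝟙[u ∈ C₂(e₂)]` vanishes on the disjointness event, so
`P[disjoint] ≤ 1 - (EN)²/EN² ≤ θ` once `EN² ≤ (1+θ)(EN)²`; `EN` is exact (switching) and `EN²` is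
bounded by the two-step bound of ADC21 Prop. A.3 once per system — `stub_chebyshev` (any finite graph,
`…Chebyshev`), moved from `ℤ³` into the box by `stub_boxPassage` (`…BoxPassage`, finitely many free box
two-point functions converge, free = plus at `β_c`).  The infinite-volume weights (`stub_assembly`,
`…Assembly`/`…AssemblyAux`): `c(u) = w_k/(|U_k| a(u)a'(u))` on doubly-toward Messager–Miracle-Solé cone
cells `U_k` (`stub_cells`, `…Cells`: `G(x-u) ≥ G(x)`, `G(x-(u-e₂)) ≥ G(x)` — the only far-point input,
one-sided, no regularity of `G` at scale `‖x‖`) at windowed, τ-decay-separated dyadic scales with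
`w_k ∝ share k = 8^k g(2^{k+2})²/B(2^{k+1})`; cross-scale pairs cost `(1+(C+1)τ)²` by one-sided P2 from
a doubling window at the larger scale (`stub_windowRegular`, `…WindowRegular`: Duminil-Copin–Panis
gradient estimate at `d = 3` + "MMS twice") and decay separation for the reversed chain; same-scale
pairs cost `4w_k²/(c₀·share k)` (evenness + MMS + the bubble); total `≤ 1 + 3η/4`.  THE FUEL: along
windowed, separated scales `Σ share = ∞` — `stub_harvestInputs` (`…HarvestInputs`: MMS shell sandwich,
dyadic axis log-convexity from reflection positivity, `B(β_c(3)) = ∞` = Duminil-Copin–Panis 2025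
Thm 1.8, infrared bound) feeds the ABSTRACT HARVEST `stub_abstractHarvest` (`…AbstractHarvestAux`,
`…AbstractHarvestBlocks`, `…AbstractHarvestCases`, `…AbstractHarvest`: ancestor lemma — a non-windowed
scale has share `≤ 1/32` of a scale at most six below it — so windowed shares diverge; a block /
saturation analysis of the greedy decay-separation chain harvests one windowed scale per alternate block
with unbounded total share; pigeonhole on residues gives index separation).
`RungOneAdjacentMerging_of` is the composition; `RungOneAdjacentMerging_proof` is its alias under the
harness's naming convention.  Where `d = 3` enters: only through `B(β_c(3)) = ∞` (the engine yields
nothing when the bubble converges, `d ≥ 5`).  The disprover's constraints (Cruxes/…/Disproof.lean v3):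
the guard `R ≤ ‖x‖` is used (`R = 2^{max𝒦+4}`), no finite-stage zero is claimed (Chebyshev gives `≤ θ`
for `θ > 0`, `n ≥ n₀`), no rate is claimed.

References: M. Aizenman, Comm. Math. Phys. 86 (1982); M. Aizenman, H. Duminil-Copin, Ann. of Math. 194
(2021), arXiv:1912.07973 (§4.2 Lemma 4.4, §6.2 (6.5), Remark 6.5, Prop. 5.9, App. A Prop. A.3);
H. Duminil-Copin, R. Panis, arXiv:2404.05700 (Thm 1.8, (1.11)); A. Messager, S. Miracle-Solé, J. Stat.
Phys. 17 (1977).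
-/

noncomputable section

open MeasureTheory Filter Finset
open scoped BigOperators ENNReal symmDiff
open Literature.Probability.LatticeModels
open Summit.CriticalPhenomena.Ising3DConformalLimit.Theses.EnergyNotSigmaSquared

namespace Summit.CriticalPhenomena.Ising3DConformalLimit.RungOneAdjacentMergingDominantShell

/-- SHARE HARVEST from its two halves: the abstract harvest (`AbstractHarvest`) applied to the harvest
inputs (`HarvestInputs`) is `ShareHarvest` verbatim (`HasWindow A k` unfolds to `a (k-4) ≤ A * a (k+4)`
and `share k` to `8^k a(k+2)²/B(k+1)` for `a j = axisG (2^j)`, `B k = Bub (2^k)`). [folklore] -/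
theorem shareHarvest_of (hI : HarvestInputs) (hA : AbstractHarvest) : ShareHarvest := by
  obtain ⟨A, hA1, h⟩ := hA _ _ hI
  refine ⟨A, hA1, fun τ hτ k₀ M => ?_⟩
  obtain ⟨𝒦, hw, hsep, hM⟩ := h τ hτ k₀ M
  refine ⟨𝒦, fun k hk => ⟨(hw k hk).1, ?_⟩, fun k hk ℓ hℓ hkℓ => hsep k hk ℓ hℓ hkℓ, ?_⟩
  · simpa [HasWindow] using (hw k hk).2
  · simpa [share] using hM

/-- The share harvest holds for the critical two-point function of `ℤ³` (stubs 5a + 5b). [folklore] -/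
theorem shareHarvest_holds : ShareHarvest := shareHarvest_of stub_harvestInputs stub_abstractHarvest

/-- The infinite-volume VARIANCE BOUND holds: for every `η > 0`, beyond some radius every far point of
`ℤ³` carries second-moment weights at level `η` (stubs 3, 4, 5a, 5b, 6). [folklore] -/
theorem varianceBound_holds : VarianceBound :=
  stub_assembly stub_cells stub_windowRegular shareHarvest_holds

/-- A variance bound, the box passage and the mean-one Chebyshev inequality give the crux (pure logic:
`η := ε/2 < θ := ε`). [folklore] -/
theorem rungOne_of_varianceBound (hcheb : MeanOneChebyshev) (hbox : BoxPassage)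
    (hvar : VarianceBound) : RungOneAdjacentMerging := by
  intro ε hε
  obtain ⟨R, hR⟩ := hvar (ε / 2) (half_pos hε)
  refine ⟨R, fun x hx => ?_⟩
  obtain ⟨n₀, hn₀⟩ := hbox x (ε / 2) ε (half_pos hε) (half_lt_self hε) (hR x hx)
  refine ⟨n₀, fun n hn o a y y' ho ha hy hy' => ?_⟩
  exact hcheb (↥(box 3 n)) ((zdGraph 3).comap (Subtype.val : ↥(box 3 n) → Site 3))
    (criticalBeta 3) (criticalBeta_nonneg 3) ε hε.le o a y y' (hn₀ n hn o a y y' ho ha hy hy')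

/-- **`RungOneAdjacentMerging` holds** — the composition of the seven stubs of the line
`dominant-shell-concentration`: STUB 6 (`stub_assembly`) fed with STUBS 3, 4 (`stub_cells`,
`stub_windowRegular`) and the harvest (STUBS 5a + 5b, `stub_harvestInputs` + `stub_abstractHarvest`)
gives the variance bound; STUB 2 (`stub_boxPassage`) moves it into the box; STUB 1 (`stub_chebyshev`)
concludes. [folklore] -/
theorem RungOneAdjacentMerging_of :
    Summit.CriticalPhenomena.Ising3DConformalLimit.Theses.EnergyNotSigmaSquared.RungOneAdjacentMerging :=
  rungOne_of_varianceBound stub_chebyshev stub_boxPassage varianceBound_holds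

/-- **`RungOneAdjacentMerging` holds** (alias of `RungOneAdjacentMerging_of` under the `_proof` naming
convention; the type is literally the route declaration). [folklore] -/
theorem RungOneAdjacentMerging_proof :
    Summit.CriticalPhenomena.Ising3DConformalLimit.Theses.EnergyNotSigmaSquared.RungOneAdjacentMerging :=
  RungOneAdjacentMerging_of

end Summit.CriticalPhenomena.Ising3DConformalLimit.RungOneAdjacentMergingDominantShell

end
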